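import Mathlib
import Summits.KontsevichZagierPeriods.Zeta5Search.BigPrimeBelowB0
import Summits.KontsevichZagierPeriods.Zeta5Search.BigPrimeSharp
import Summits.KontsevichZagierPeriods.Zeta5Search.BigPrimeMinors
import HarnessLib

/-!
# ζ(5) search — (W∞) below `b₀`: integrality, sharpness and the congruence `W ≡ 2 (mod d+2)`

Cell `pub-zeta5` (HONEST FRAMING: systematic search; no irrationality claim unless certified), typer seat
generation 7.  Companion of `BigPrimeBelowB0.lean` (window `max(5, b₀+1−2b_{j₂}) ≤ p ≤ d(b)+1`, `j₂` minimal among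
the slots other than a dropped `j₁`).  OUR theorems; coefficient arithmetic only.
* `padicNorm_coeffW_le_one_of_slot`, `padicNorm_coeffU_le_one_of_slot`: `W(b)`, `U(b)` are `p`-INTEGRAL for every prime
  `p` with `b₀ + 1 ≤ p + 2b_{j₂}` (no other condition) — the poles of `R_b` live on the support `S` and their
  differences are `< p`.  With the divisibility theorem this gives the OBSERVED law (WV) of `CasoratianValuation`
  at every prime `p ≥ max(5, b₀+1−2b₍₂₎)` (there `a_p ≤ N_p`, so (WV) asks for `min(1,⌊(d+1)/p⌋) ≤ v_p(W)` at most),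
  and in the heavy range `p ≤ b₀ − 2b_min` it is STRONGER than (WV) as typed (e.g. `b = (20;0,9⁶)`: `5, 7 ∣ W`).
* `natDegree_MS`, `leadingCoeff_MS`: the reduced dual polynomial has degree `6p − 6n − 5 + 2Σβ_j` exactly and leading
  coefficient `2`.
* **`padicValRat_coeffW_excess_add_two_of_slot`**: for the prime `p = d(b)+2` in that range, `W(b) ≠ 0`, `v_p(W(b)) = 0`,
  and (`padicNorm_coeffW_sub_two_le_of_slot`) **`W(b) ≡ 2 (mod p)`**; the `U`-versions at `2p = d(b)+2`.  Prototype check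
  (exact arithmetic, `p ≤ b₀`): 144/144 and 66/66.
-/

noncomputable section

open Finset Polynomial

namespace Summit.KontsevichZagierPeriods.Zeta5Search.BigPrime

open Summit.KontsevichZagierPeriods.Zeta5Search.DualSeries (InBox)
open Summit.KontsevichZagierPeriods.Zeta5Search.WedgeDictionary (IsPFData coeffU coeffW coeffU_eq coeffW_eq
  exists_isPFData dOf)

/-! ### `p`-integrality on the support -/

section Integral

variable {p : ℕ} [hp : Fact p.Prime]

/-- For `b₀ + 1 ≤ p + 2b_{j₂}` every partial-fraction coefficient `c_{o,q}` of `R_b` is `p`-integral. -/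
theorem padicNorm_pf_le_one_of_slot (b : ℕ → ℤ) (hb : InBox b) (hhalf : ∀ j ∈ range 7, 2 * b (j + 1) ≤ b 0 + 1)
    {c : ℕ → ℕ → ℚ} (hc : IsPFData b c) {j₁ j₂ : ℕ} (hj₁ : j₁ ∈ range 7)
    (hmin : ∀ j ∈ range 7, j ≠ j₁ → (b (j₂ + 1)).toNat ≤ (b (j + 1)).toNat)
    (hS : (b 0).toNat + 1 ≤ p + 2 * (b (j₂ + 1)).toNat) {q : ℕ} (hq : q ≤ (b 0).toNat) {o : ℕ} (ho : o < 6) :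
    padicNorm p (c o q) ≤ 1 := by
  by_cases hqS : q ∈ block (b 0).toNat (b (j₂ + 1)).toNat
  · have h := pf_coeff_eqS b hb hhalf hc hj₁ hmin hqS ho
    have hu : ¬ (p : ℤ) ∣ eS0 (b 0).toNat (fun j => (b (j + 1)).toNat) j₂ q ^ 6 := fun hd =>
      not_dvd_eS0 (β := fun j => (b (j + 1)).toNat) hp.out hS hqS
        ((Nat.prime_iff_prime_int.1 hp.out).dvd_of_dvd_pow hd)
    exact padicNorm_le_one_of_mul_eq hu (by push_cast; exact h)
  · rw [pf_eq_zero_of_not_mem b hb hhalf hc hj₁ hmin hq hqS ho, padicNorm.zero]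
    exact zero_le_one

/-- **`W(b)` and `U(b)` are `p`-integral for every prime with `b₀ + 1 ≤ p + 2 b_{j₂}`** (`j₂` minimal among the
slots other than some `j₁`; no lower bound on `p` otherwise). -/
theorem padicNorm_coeff_le_one_of_slot (b : ℕ → ℤ) (j₁ j₂ : ℕ) (hb : InBox b)
    (h2 : ∀ i ∈ range 7, 2 * b (i + 1) ≤ b 0) (h3 : ∑ i ∈ range 7, b (i + 1) ≤ 3 * b 0)
    (hj₁ : j₁ ∈ range 7) (hmin : ∀ j ∈ range 7, j ≠ j₁ → b (j₂ + 1) ≤ b (j + 1))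
    (hpS : b 0 + 1 ≤ (p : ℤ) + 2 * b (j₂ + 1)) :
    padicNorm p (coeffW b) ≤ 1 ∧ padicNorm p (coeffU b) ≤ 1 := by
  have h0 : 0 ≤ b 0 := hb.1
  have hmin' : ∀ j ∈ range 7, j ≠ j₁ → (b (j₂ + 1)).toNat ≤ (b (j + 1)).toNat :=
    fun j hj hne => Int.toNat_le_toNat (hmin j hj hne)
  have hpS' : (b 0).toNat + 1 ≤ p + 2 * (b (j₂ + 1)).toNat := by
    have := Int.self_le_toNat (b (j₂ + 1)); omega
  have hhalf : ∀ j ∈ range 7, 2 * b (j + 1) ≤ b 0 + 1 := fun j hj => by have := h2 j hj; omega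
  obtain ⟨c, hc⟩ := exists_isPFData b hb (by omega)
  have hcq : ∀ q ∈ range ((b 0).toNat + 1), ∀ o, o < 6 → padicNorm p (c o q) ≤ 1 := fun q hq o ho =>
    padicNorm_pf_le_one_of_slot b hb hhalf hc hj₁ hmin' hpS' (Nat.lt_succ_iff.1 (mem_range.1 hq)) ho
  refine ⟨?_, ?_⟩
  · rw [coeffW_eq hc]
    exact padicNorm.sum_le' (fun q hq => hcq q hq 2 (by norm_num)) zero_le_one
  · rw [coeffU_eq hc]
    exact padicNorm.sum_le' (fun q hq => hcq q hq 4 (by norm_num)) zero_le_one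

end Integral

/-! ### Exact degree and leading coefficient of the reduced dual polynomial -/

section Degree

variable {p : ℕ} [hp : Fact p.Prime]

/-- `deg M^S + 6n + 5 = 6p + 2Σ_j β_j` exactly. -/
theorem natDegree_MS {n : ℕ} {β : ℕ → ℕ} {j₁ j₂ : ℕ} (hj₁ : j₁ ∈ range 7) (hp3 : 3 ≤ p)
    (hS : n + 1 ≤ p + 2 * β j₂) (hmin : ∀ j ∈ range 7, j ≠ j₁ → β j₂ ≤ β j)
    (hβ : ∀ j ∈ range 7, 2 * β j ≤ n) :
    (MS p n β j₁).natDegree + 6 * n + 5 = 6 * p + 2 * ∑ j ∈ range 7, β j := by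
  have h2 : (2 : ZMod p) ≠ 0 := by
    change ((2 : ℕ) : ZMod p) ≠ 0
    rw [Ne, ZMod.natCast_eq_zero_iff]
    intro h; have := Nat.le_of_dvd (by norm_num) h; omega
  have hlin : (C (2 : ZMod p) * X + C (n : ZMod p)).natDegree = 1 := natDegree_linear h2
  have hmid_monic : (∏ s ∈ range (n + 1) \ block n (β j₁), (X + C (s : ZMod p))).Monic :=
    monic_prod_of_monic _ _ fun s _ => monic_X_add_C _
  have hmid : (∏ s ∈ range (n + 1) \ block n (β j₁), (X + C (s : ZMod p))).natDegree = 2 * β j₁ := by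
    rw [natDegree_prod_of_monic _ _ fun s _ => monic_X_add_C _]
    have hcard : #(range (n + 1) \ block n (β j₁)) = 2 * β j₁ := by
      have h1 := card_sdiff_add_card_eq_card (block_subset n (β j₁))
      rw [block, Nat.card_Icc, card_range] at h1
      have := hβ j₁ hj₁
      rw [block]
      omega
    simp only [natDegree_X_add_C, sum_const, smul_eq_mul, mul_one, hcard]
  have hK_monic : ∀ j ∈ (range 7).erase j₁, (KF p n (β j)).Monic :=
    fun j _ => monic_prod_of_monic _ _ fun u _ => monic_X_add_C _
  have hprod_monic : (∏ j ∈ (range 7).erase j₁, KF p n (β j)).Monic := monic_prod_of_monic _ _ hK_monic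
  have hK : ∀ j ∈ (range 7).erase j₁, (KF p n (β j)).natDegree + (n + 1) = p + 2 * β j := by
    intro j hj
    have hj' := mem_erase.1 hj
    have hb := hβ j hj'.2
    have hsub : block n (β j) ⊆ block n (β j₂) := block_mono (hmin j hj'.2 hj'.1)
    have hcard : #(blockF p n (β j)) = (n - β j) + 1 - β j := by
      rw [blockF, card_image_of_injOn ((cast_injOn_block hS).mono (by exact_mod_cast hsub)), block, Nat.card_Icc]
    have hdeg : (KF p n (β j)).natDegree = p - #(blockF p n (β j)) := by
      rw [KF, natDegree_prod_of_monic _ _ fun u _ => monic_X_add_C _]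
      simp only [natDegree_X_add_C, sum_const, card_univ_sdiff, ZMod.card, smul_eq_mul, mul_one]
    rw [hdeg, hcard]
    have hmin' := hmin j hj'.2 hj'.1
    have : #(blockF p n (β j)) ≤ p := by rw [hcard]; omega
    omega
  have hKsum : (∏ j ∈ (range 7).erase j₁, KF p n (β j)).natDegree + 6 * (n + 1) =
      6 * p + 2 * ∑ j ∈ (range 7).erase j₁, β j := by
    rw [natDegree_prod_of_monic _ _ hK_monic]
    have := sum_congr rfl hK
    rw [sum_add_distrib, sum_const, card_erase_of_mem hj₁, card_range, smul_eq_mul, sum_add_distrib, sum_const,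
      card_erase_of_mem hj₁, card_range, smul_eq_mul, ← mul_sum] at this
    omega
  have hlin0 : (C (2 : ZMod p) * X + C (n : ZMod p)) ≠ 0 :=
    ne_zero_of_natDegree_gt (n := 0) (by rw [hlin]; norm_num)
  have hd1 : ((C (2 : ZMod p) * X + C (n : ZMod p)) *
      ∏ s ∈ range (n + 1) \ block n (β j₁), (X + C (s : ZMod p))).natDegree = 1 + 2 * β j₁ := by
    rw [natDegree_mul' (by rw [hmid_monic.leadingCoeff, mul_one, leadingCoeff_linear h2]; exact h2), hlin, hmid]
  have hne1 : (C (2 : ZMod p) * X + C (n : ZMod p)) *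
      ∏ s ∈ range (n + 1) \ block n (β j₁), (X + C (s : ZMod p)) ≠ 0 := mul_ne_zero hlin0 hmid_monic.ne_zero
  have hMS : (MS p n β j₁).natDegree = 1 + 2 * β j₁ + (∏ j ∈ (range 7).erase j₁, KF p n (β j)).natDegree := by
    rw [MS, natDegree_mul' (by rw [hprod_monic.leadingCoeff, mul_one]; exact leadingCoeff_ne_zero.2 hne1), hd1]
  have h3 : ∑ j ∈ (range 7).erase j₁, β j + β j₁ = ∑ j ∈ range 7, β j := sum_erase_add _ _ hj₁
  omega

/-- The leading coefficient of `M^S` is `2`. -/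
theorem leadingCoeff_MS {n : ℕ} (hp3 : 3 ≤ p) (β : ℕ → ℕ) (j₁ : ℕ) : (MS p n β j₁).leadingCoeff = 2 := by
  have h2 : (2 : ZMod p) ≠ 0 := by
    change ((2 : ℕ) : ZMod p) ≠ 0
    rw [Ne, ZMod.natCast_eq_zero_iff]
    intro h; have := Nat.le_of_dvd (by norm_num) h; omega
  have hmid_monic : (∏ s ∈ range (n + 1) \ block n (β j₁), (X + C (s : ZMod p))).Monic :=
    monic_prod_of_monic _ _ fun s _ => monic_X_add_C _
  have hprod_monic : (∏ j ∈ (range 7).erase j₁, KF p n (β j)).Monic :=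
    monic_prod_of_monic _ _ fun j _ => monic_prod_of_monic _ _ fun u _ => monic_X_add_C _
  rw [MS, leadingCoeff_mul, leadingCoeff_mul, leadingCoeff_linear h2, hmid_monic.leadingCoeff,
    hprod_monic.leadingCoeff, mul_one, mul_one]

end Degree

/-! ### Sharpness and the congruence below `b₀` -/

section SharpS

/-- The cleared numerator at the critical prime: `Z^S ≡ 2·U^S (mod p)` when `deg M^S` is critical for the order `r`. -/
theorem ZSsum_cast_critical {p : ℕ} [hp : Fact p.Prime] (hp5 : 5 ≤ p) {n : ℕ} {β : ℕ → ℕ} {j₁ j₂ : ℕ}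
    (hj₁ : j₁ ∈ range 7) (hS : n + 1 ≤ p + 2 * β j₂) (hmin : ∀ j ∈ range 7, j ≠ j₁ → β j₂ ≤ β j)
    {r : ℕ} (hr1 : r = 1 ∨ r = 3) (hdeg : (MS p n β j₁).natDegree = r + (r + 1) * (p - 1)) :
    ((ZSsum n β j₁ j₂ r : ℤ) : ZMod p) = 2 * ((USall n β j₂ : ℤ) : ZMod p) := by
  rw [ZSsum_cast hp5 hj₁ hS hmin (by omega), sum_taylor_coeff_top _ r (by omega) hdeg, leadingCoeff_MS (by omega)]
  rcases hr1 with rfl | rfl <;> ring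

/-- **(W∞) below `b₀` is SHARP**: for the prime `p = d(b)+2` with `max(5, b₀+1−2b_{j₂}) ≤ p`, `W(b) ≠ 0` and
`v_p(W(b)) = 0`. -/
theorem padicValRat_coeffW_excess_add_two_of_slot (b : ℕ → ℤ) (p j₁ j₂ : ℕ) (hb : InBox b)
    (h2 : ∀ i ∈ range 7, 2 * b (i + 1) ≤ b 0) (h3 : ∑ i ∈ range 7, b (i + 1) ≤ 3 * b 0)
    (hj₁ : j₁ ∈ range 7) (hmin : ∀ j ∈ range 7, j ≠ j₁ → b (j₂ + 1) ≤ b (j + 1))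
    (hprime : p.Prime) (hp5 : 5 ≤ p) (hpS : b 0 + 1 ≤ (p : ℤ) + 2 * b (j₂ + 1)) (hpd : (p : ℤ) = dOf b + 2) :
    coeffW b ≠ 0 ∧ padicValRat p (coeffW b) = 0 := by
  haveI : Fact p.Prime := ⟨hprime⟩
  obtain ⟨e0, hS, hβ, hS3⟩ := polytope_data b hb h2 h3
  have hmin' : ∀ j ∈ range 7, j ≠ j₁ → (b (j₂ + 1)).toNat ≤ (b (j + 1)).toNat :=
    fun j hj hne => Int.toNat_le_toNat (hmin j hj hne)
  have hpS' : (b 0).toNat + 1 ≤ p + 2 * (b (j₂ + 1)).toNat := by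
    have := Int.self_le_toNat (b (j₂ + 1)); omega
  have hpd' : p + ∑ j ∈ range 7, (b (j + 1)).toNat = 3 * (b 0).toNat + 2 := by
    have := hpd; rw [dOf, hS, e0] at this; omega
  have hhalf : ∀ j ∈ range 7, 2 * b (j + 1) ≤ b 0 + 1 := fun j hj => by have := h2 j hj; omega
  obtain ⟨c, hc⟩ := exists_isPFData b hb (by omega)
  have hUW := USall_mul_sum_eq b hb hhalf hc hj₁ hmin' (o := 2) (by norm_num)
  rw [← coeffW_eq hc] at hUW
  refine padicValRat_eq_zero_of_eq hUW (not_dvd_USall hprime hpS') ?_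
  have hdeg : (MS p (b 0).toNat (fun j => (b (j + 1)).toNat) j₁).natDegree = 3 + (3 + 1) * (p - 1) := by
    have := natDegree_MS (p := p) hj₁ (by omega) hpS' hmin' hβ
    beta_reduce at this
    omega
  rw [← ZMod.intCast_zmod_eq_zero_iff_dvd, show (5 - 2 : ℕ) = 3 by norm_num,
    ZSsum_cast_critical hp5 hj₁ hpS' hmin' (Or.inr rfl) hdeg]
  have hU : ((USall (b 0).toNat (fun j => (b (j + 1)).toNat) j₂ : ℤ) : ZMod p) ≠ 0 := by
    rw [Ne, ZMod.intCast_zmod_eq_zero_iff_dvd]; exact not_dvd_USall hprime hpS'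
  have htwo : (2 : ZMod p) ≠ 0 := by
    change ((2 : ℕ) : ZMod p) ≠ 0
    rw [Ne, ZMod.natCast_eq_zero_iff]
    intro h; have := Nat.le_of_dvd (by norm_num) h; omega
  exact mul_ne_zero htwo hU

/-- **`W(b) ≡ 2 (mod p)` at `p = d(b)+2`** below `b₀` as well: `‖W(b) − 2‖_p ≤ p⁻¹`. -/
theorem padicNorm_coeffW_sub_two_le_of_slot (b : ℕ → ℤ) (p j₁ j₂ : ℕ) (hb : InBox b)
    (h2 : ∀ i ∈ range 7, 2 * b (i + 1) ≤ b 0) (h3 : ∑ i ∈ range 7, b (i + 1) ≤ 3 * b 0)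
    (hj₁ : j₁ ∈ range 7) (hmin : ∀ j ∈ range 7, j ≠ j₁ → b (j₂ + 1) ≤ b (j + 1))
    (hprime : p.Prime) (hp5 : 5 ≤ p) (hpS : b 0 + 1 ≤ (p : ℤ) + 2 * b (j₂ + 1)) (hpd : (p : ℤ) = dOf b + 2) :
    padicNorm p (coeffW b - 2) ≤ (p : ℚ)⁻¹ := by
  haveI : Fact p.Prime := ⟨hprime⟩
  obtain ⟨e0, hS, hβ, hS3⟩ := polytope_data b hb h2 h3
  have hmin' : ∀ j ∈ range 7, j ≠ j₁ → (b (j₂ + 1)).toNat ≤ (b (j + 1)).toNat :=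
    fun j hj hne => Int.toNat_le_toNat (hmin j hj hne)
  have hpS' : (b 0).toNat + 1 ≤ p + 2 * (b (j₂ + 1)).toNat := by
    have := Int.self_le_toNat (b (j₂ + 1)); omega
  have hpd' : p + ∑ j ∈ range 7, (b (j + 1)).toNat = 3 * (b 0).toNat + 2 := by
    have := hpd; rw [dOf, hS, e0] at this; omega
  have hhalf : ∀ j ∈ range 7, 2 * b (j + 1) ≤ b 0 + 1 := fun j hj => by have := h2 j hj; omega
  obtain ⟨c, hc⟩ := exists_isPFData b hb (by omega)
  have hUW := USall_mul_sum_eq b hb hhalf hc hj₁ hmin' (o := 2) (by norm_num)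
  rw [← coeffW_eq hc] at hUW
  have hdeg : (MS p (b 0).toNat (fun j => (b (j + 1)).toNat) j₁).natDegree = 3 + (3 + 1) * (p - 1) := by
    have := natDegree_MS (p := p) hj₁ (by omega) hpS' hmin' hβ
    beta_reduce at this
    omega
  have hZ := ZSsum_cast_critical hp5 hj₁ hpS' hmin' (Or.inr rfl) hdeg
  set U : ℤ := USall (b 0).toNat (fun j => (b (j + 1)).toNat) j₂ with hUdef
  set Z : ℤ := ZSsum (b 0).toNat (fun j => (b (j + 1)).toNat) j₁ j₂ 3 with hZdef
  have hU : ¬ (p : ℤ) ∣ U := not_dvd_USall hprime hpS'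
  have hU0 : (U : ℚ) ≠ 0 := by exact_mod_cast fun h => hU (by rw [h]; exact dvd_zero _)
  have hdvd : (p : ℤ) ∣ Z - 2 * U := by
    rw [← ZMod.intCast_zmod_eq_zero_iff_dvd]; push_cast; rw [hZ]; ring
  have hUW' : (U : ℚ) * coeffW b = Z := by rw [hZdef, show (3 : ℕ) = 5 - 2 by norm_num]; exact hUW
  have heq : coeffW b - 2 = ((Z - 2 * U : ℤ) : ℚ) / (U : ℚ) := by
    rw [eq_div_iff hU0]; push_cast; linear_combination hUW'
  rw [heq, padicNorm.div, (padicNorm.int_eq_one_iff _).2 hU, div_one, ← zpow_neg_one]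
  exact (padicNorm.dvd_iff_norm_le (n := 1)).1 (by simpa using hdvd)

/-- **(U∞) below `b₀` is sharp**: at `2p = d(b)+2`, `U(b) ≠ 0` and `v_p(U(b)) = 0`. -/
theorem padicValRat_coeffU_half_excess_add_one_of_slot (b : ℕ → ℤ) (p j₁ j₂ : ℕ) (hb : InBox b)
    (h2 : ∀ i ∈ range 7, 2 * b (i + 1) ≤ b 0) (h3 : ∑ i ∈ range 7, b (i + 1) ≤ 3 * b 0)
    (hj₁ : j₁ ∈ range 7) (hmin : ∀ j ∈ range 7, j ≠ j₁ → b (j₂ + 1) ≤ b (j + 1))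
    (hprime : p.Prime) (hp5 : 5 ≤ p) (hpS : b 0 + 1 ≤ (p : ℤ) + 2 * b (j₂ + 1))
    (hpd : 2 * (p : ℤ) = dOf b + 2) : coeffU b ≠ 0 ∧ padicValRat p (coeffU b) = 0 := by
  haveI : Fact p.Prime := ⟨hprime⟩
  obtain ⟨e0, hS, hβ, hS3⟩ := polytope_data b hb h2 h3
  have hmin' : ∀ j ∈ range 7, j ≠ j₁ → (b (j₂ + 1)).toNat ≤ (b (j + 1)).toNat :=
    fun j hj hne => Int.toNat_le_toNat (hmin j hj hne)
  have hpS' : (b 0).toNat + 1 ≤ p + 2 * (b (j₂ + 1)).toNat := by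
    have := Int.self_le_toNat (b (j₂ + 1)); omega
  have hpd' : 2 * p + ∑ j ∈ range 7, (b (j + 1)).toNat = 3 * (b 0).toNat + 2 := by
    have := hpd; rw [dOf, hS, e0] at this; omega
  have hhalf : ∀ j ∈ range 7, 2 * b (j + 1) ≤ b 0 + 1 := fun j hj => by have := h2 j hj; omega
  obtain ⟨c, hc⟩ := exists_isPFData b hb (by omega)
  have hUW := USall_mul_sum_eq b hb hhalf hc hj₁ hmin' (o := 4) (by norm_num)
  rw [← coeffU_eq hc] at hUW
  refine padicValRat_eq_zero_of_eq hUW (not_dvd_USall hprime hpS') ?_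
  have hdeg : (MS p (b 0).toNat (fun j => (b (j + 1)).toNat) j₁).natDegree = 1 + (1 + 1) * (p - 1) := by
    have := natDegree_MS (p := p) hj₁ (by omega) hpS' hmin' hβ
    beta_reduce at this
    omega
  rw [← ZMod.intCast_zmod_eq_zero_iff_dvd, show (5 - 4 : ℕ) = 1 by norm_num,
    ZSsum_cast_critical hp5 hj₁ hpS' hmin' (Or.inl rfl) hdeg]
  have hU : ((USall (b 0).toNat (fun j => (b (j + 1)).toNat) j₂ : ℤ) : ZMod p) ≠ 0 := by
    rw [Ne, ZMod.intCast_zmod_eq_zero_iff_dvd]; exact not_dvd_USall hprime hpS'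
  have htwo : (2 : ZMod p) ≠ 0 := by
    change ((2 : ℕ) : ZMod p) ≠ 0
    rw [Ne, ZMod.natCast_eq_zero_iff]
    intro h; have := Nat.le_of_dvd (by norm_num) h; omega
  exact mul_ne_zero htwo hU

end SharpS

end Summit.KontsevichZagierPeriods.Zeta5Search.BigPrime

end
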